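import Summits.CriticalPhenomena.PercolationContinuityZ3.Theorems.PercNearOneGluingNoHeavyQuantCritOneArmProduct
import Summits.CriticalPhenomena.PercolationContinuityZ3.Theorems.PercNearOneGluingNoHeavyQuantThetaModulus
import Summits.CriticalPhenomena.PercolationContinuityZ3.Theorems.PercNearOneGluingNoHeavyLowerTailCSHTheoremOne
import HarnessLib

/-!
# The intrinsic (T1) ⇒ (T2) dictionary: one-arm exponent `c` and critical box-susceptibility exponent `s` give the Hölder
# exponent `2c/(c+s)` for `θ` at `p_c⁺` — mean-field sharp (`c = s = 2 ⇒ β ≥ 1`) — quant lane, seat p4 gen 11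

builds on p205010 (kernel theorem, internal audit signed; external expert review pending) — used at the single point
`p = p_c` (`θ(p_c) = 0`, `CSH.percolationContinuity_allDimensions`), exactly as in the lane's earlier Hölder transfers.
Status sentence for p205010: "θ(p_c) = 0 on ℤ^d, all d ≥ 2 — kernel-verified (Lean 4/Mathlib, standard
axioms); internal adversarial audit SIGNED 2026-08-20 04:29Z; external expert review pending."

Seat `prim-quant-p4` (METHOD = differential inequalities near `p_c`), `--supports stmt-CriticalPhenomena-4575`; pure proofs,
no definitions.  Sequel of `…QuantCritOneArmProduct.lean` (`CritOneArm.theta_le_two_mul_oneArmProb_add`: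
`θ(q) ≤ 2π_N(p_c) + (32d/(p_c(1−p_c)))(q−p_c)² χ^Λ_N(p_c)` for `q ∈ (p_c,(1+p_c)/2]`, every `N`, where
`χ^Λ_N(p) = Σ_{y ∈ Λ_N} P_p(0 ↔ y in Λ_N) = E_p|C_{Λ_N}(0)|`).

* **`CritOneArm.thetaHolderNearCritical_of_oneArm_boxSusceptibility`** — if `π_N(p_c) ≤ A N^{−c}` and `χ^Λ_N(p_c) ≤ B N^{s}`
  for all `N ≥ 1` (`c, s > 0`), then `Quant.ThetaHolderNearCritical d (2c/(c+s)) C'` with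
  `C' = 2A + (32d/(p_c(1−p_c))) B 2^s + (2/(1−p_c))^{2c/(c+s)}` (choose `N = ⌈ε^{−2/(c+s)}⌉`, `ε = p − p_c`).
  The lane's dictionary of record (gens 4–5: (T1) exponent `c` ⇒ (T2) exponent `2c/d`, from Newman's volume route) is the
  case `s = d`... no: it is BETTER than the trivial instance `s = d` of this one (`2c/(c+d)`), and WORSE than this one as soon
  as `s < d − c`; above the upper critical dimension `c = s = 2` and the exponent here is `1 = β_MF` (sharp), against `4/d`.
  In exponent language this is the hyperscaling-free inequality `β ≥ 2/(1 + ρ(2−η))` (`π_N ≈ N^{−1/ρ}`, `χ^Λ_N ≈ N^{2−η}`),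
  i.e. Newman's `β ≥ 2/δ` with `δ` replaced by `1 + ρ(2−η)` (equal to `δ` in `d = 2` and in mean field).
* **`thetaHolderNearCritical_of_oneArm_twoPoint_upper`** — with `τ_{p_c}(0,y) ≤ C‖y‖^{2−d}` (`d ≥ 3`) one may take
  `s = 2`, `B = 1 + 2dC·3^{d−1}`: exponent `2c/(c+2)`.
* **`betaEqOneBoundedRatio_of_oneArm_two_twoPoint_upper`** — if moreover `π_N(p_c) ≤ A/N²` (`c = 2`, Kozma–Nachmias's
  upper bound), then `θ(p) ≤ C'(p − p_c)` for all `p ≥ p_c`, hence (with the tree's mean-field lower bound) `β = 1` in the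
  bounded-ratio sense: **`BetaEqOneBoundedRatio d`**; packaged: **`betaEqOneBoundedRatio_of_rhoExHalf_twoPointBoundedRatio`**
  (`RhoExHalf d → TwoPointBoundedRatio d → BetaEqOneBoundedRatio d`, `d ≥ 3`, using only the two UPPER halves).

HONEST PLACEMENT.  Typed transfers (conditional dictionary rows); their hypotheses are open for `3 ≤ d ≤ 6` and are named
facts (lace expansion, Kozma–Nachmias) for `d ≥ 11`/`d > 6` in the tree; `β = 1` under the triangle condition is PRINTED
(Barsky–Aizenman 1991) and in the tree conditionally on Aizenman–Newman's `γ = 1` — the route here (`ρ`- and `η`-upper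
halves ⇒ `β`-upper half) is different and not found in print in this form.  Nothing here is a rate in `d = 3`.

## References
* T. Hutchcroft, J. Stat. Phys. 189 (2022) no. 6, Thm. 1.3 [Hutchcroft2022Triangle]; C. M. Newman, J. Stat. Phys. 47 (1987)
  (`β ≥ 2/δ`) [Newman1987BetaDelta].
* G. Kozma, A. Nachmias, J. Amer. Math. Soc. 24 (2011), Thm. 1 [KozmaNachmias2011]; M. Heydenreich, R. van der Hofstad (2017),
  Thm. 4.1, Thm. 11.4–11.5 [HeydenreichVanDerHofstad2017]; D. J. Barsky, M. Aizenman, Ann. Probab. 19 (1991) [BarskyAizenman1991].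
-/

noncomputable section

namespace Summit.CriticalPhenomena.PercolationContinuityZ3.Theorems

namespace CritOneArm

open MeasureTheory Set Filter Topology Literature.Probability.Percolation Literature.Probability.LatticeModels
open scoped Classical

variable {d : ℕ}

/-- **The intrinsic (T1) ⇒ (T2) dictionary.**  If `π_N(p_c) ≤ A N^{−c}` and `χ^Λ_N(p_c) ≤ B N^{s}` for all `N ≥ 1`
(`c, s > 0`), then `θ(p) ≤ C' (p − p_c)^{2c/(c+s)}` for every `p ≥ p_c`,
`C' = 2A + (32d/(p_c(1−p_c))) B 2^s + (2/(1−p_c))^{2c/(c+s)}`.  Proof: for `0 < ε = p − p_c ≤ (1−p_c)/2` take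
`N = ⌈ε^{−2/(c+s)}⌉` in `theta_le_two_mul_oneArmProb_add` (`N^{−c} ≤ ε^{2c/(c+s)}`, `ε² N^s ≤ 2^s ε^{2c/(c+s)}`); for larger
`ε`, `θ ≤ 1 ≤ (2ε/(1−p_c))^{2c/(c+s)}`; at `ε = 0`, `θ(p_c) = 0` (p205010).  Mean-field sharp (`c = s = 2`: exponent `1`).
builds on p205010 (kernel theorem, internal audit signed; external expert review pending).
[cite: Hutchcroft2022Triangle, Thm. 1.3] [cite: Newman1987BetaDelta, Theorem (β ≥ 2/δ)] -/
theorem thetaHolderNearCritical_of_oneArm_boxSusceptibility (hd : 2 ≤ d) {c s A B : ℝ} (hc : 0 < c) (hs : 0 < s)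
    (hA : ∀ N : ℕ, 1 ≤ N → oneArmProb d (criticalProbI d) N ≤ A * (N : ℝ) ^ (-c))
    (hB : ∀ N : ℕ, 1 ≤ N → ∑ y ∈ box d N, (bondPercolation (zdGraph d) (criticalProbI d)).real
      (openConnIn (↑(box d N) : Set (Site d)) 0 y) ≤ B * (N : ℝ) ^ s) :
    Quant.ThetaHolderNearCritical d (2 * c / (c + s))
      (2 * A + 32 * d / ((criticalProbI d : ℝ) * (1 - criticalProbI d)) * B * 2 ^ s +
        (2 / (1 - (criticalProbI d : ℝ))) ^ (2 * c / (c + s))) := by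
  have hd1 : 1 ≤ d := by omega
  set pc : ℝ := (criticalProbI d : ℝ) with hpcdef
  have hpc0 : 0 < pc := criticalProb_zd_pos d hd1
  have hpc1 : pc < 1 := criticalProb_zd_lt_one hd
  have hv0 : 0 < pc * (1 - pc) := mul_pos hpc0 (by linarith)
  set b : ℝ := 2 * c / (c + s) with hbdef
  have hcs : 0 < c + s := by linarith
  have hb0 : 0 < b := div_pos (by linarith) hcs
  set K : ℝ := 32 * d / (pc * (1 - pc)) with hKdef
  have hK0 : 0 ≤ K := div_nonneg (by positivity) hv0.le
  -- `A, B ≥ 0`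
  have hA0 : 0 ≤ A := by
    have h := hA 1 le_rfl
    simp only [Nat.cast_one, Real.one_rpow, mul_one] at h
    exact le_trans measureReal_nonneg h
  have hB0 : 0 ≤ B := by
    have h := hB 1 le_rfl
    simp only [Nat.cast_one, Real.one_rpow, mul_one] at h
    exact le_trans (zero_le_one.trans (one_le_boxSum (criticalProbI d) 1)) h
  set ε₀ : ℝ := (1 - pc) / 2 with hε₀def
  have hε₀0 : 0 < ε₀ := by rw [hε₀def]; linarith
  have hbig0 : 0 ≤ (2 / (1 - pc)) ^ b := Real.rpow_nonneg (by positivity) _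
  intro p hp
  change pc ≤ (p : ℝ) at hp
  set ε : ℝ := (p : ℝ) - pc with hεdef
  have hε0 : 0 ≤ ε := by rw [hεdef]; linarith
  show theta (zdGraph d) 0 p ≤ (2 * A + K * B * 2 ^ s + (2 / (1 - pc)) ^ b) * ε ^ b
  rcases hε0.eq_or_lt with hεz | hεpos
  · -- `p = p_c`: θ(p_c) = 0 (p205010)
    have hpp : p = criticalProbI d := Subtype.ext (by rw [← hpcdef]; linarith)
    rw [hpp, show theta (zdGraph d) 0 (criticalProbI d) = 0 from CSH.percolationContinuity_allDimensions d hd, ← hεz,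
      Real.zero_rpow hb0.ne', mul_zero]
  have hεb0 : 0 < ε ^ b := Real.rpow_pos_of_pos hεpos b
  by_cases hsmall : ε ≤ ε₀
  · -- the window regime
    have hε1 : ε ≤ 1 := hsmall.trans (by rw [hε₀def]; linarith)
    set t : ℝ := ε ^ (-(2 / (c + s))) with htdef
    have ht1 : 1 ≤ t := Real.one_le_rpow_of_pos_of_le_one_of_nonpos hεpos hε1 (by
      have : 0 < 2 / (c + s) := div_pos two_pos hcs
      linarith)
    have ht0 : 0 < t := by linarith
    set N : ℕ := ⌈t⌉₊ with hNdef
    have hNt : t ≤ N := Nat.le_ceil t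
    have hN1 : 1 ≤ N := by
      have : 0 < N := Nat.ceil_pos.2 ht0
      omega
    have hNpos : (0 : ℝ) < N := by exact_mod_cast (show 0 < N by omega)
    have hN2t : (N : ℝ) ≤ 2 * t := by
      have := Nat.ceil_lt_add_one ht0.le
      rw [← hNdef] at this
      linarith
    -- the transfer at scale `N`
    have hq2 : ((p : ℝ)) ≤ (1 + criticalProbI d) / 2 := by
      rw [← hpcdef]; rw [hε₀def] at hsmall; linarith
    have hT := theta_le_two_mul_oneArmProb_add hd N p (by rw [← hpcdef]; linarith) hq2
    rw [← hpcdef] at hT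
    -- `π_N ≤ A t^{-c} = A ε^b`
    have htc : t ^ (-c) = ε ^ b := by
      rw [htdef, ← Real.rpow_mul hεpos.le]
      congr 1
      rw [hbdef]; field_simp
    have hπ : oneArmProb d (criticalProbI d) N ≤ A * ε ^ b := by
      refine (hA N hN1).trans ?_
      rw [← htc]
      refine mul_le_mul_of_nonneg_left ?_ hA0
      exact Real.antitoneOn_rpow_Ioi_of_exponent_nonpos (by linarith) ht0 hNpos hNt
    -- `ε² χ ≤ B 2^s ε^b`
    have hts : t ^ s = ε ^ (-(2 * s / (c + s))) := by
      rw [htdef, ← Real.rpow_mul hεpos.le]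
      congr 1
      field_simp
    have hχ : ε ^ 2 * ∑ y ∈ box d N, (bondPercolation (zdGraph d) (criticalProbI d)).real
        (openConnIn (↑(box d N) : Set (Site d)) 0 y) ≤ B * 2 ^ s * ε ^ b := by
      have h1 : ∑ y ∈ box d N, (bondPercolation (zdGraph d) (criticalProbI d)).real
          (openConnIn (↑(box d N) : Set (Site d)) 0 y) ≤ B * (2 ^ s * t ^ s) := by
        refine (hB N hN1).trans (mul_le_mul_of_nonneg_left ?_ hB0)
        calc (N : ℝ) ^ s ≤ (2 * t) ^ s := Real.rpow_le_rpow hNpos.le hN2t hs.le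
          _ = 2 ^ s * t ^ s := Real.mul_rpow (by norm_num) ht0.le
      have h2 : ε ^ 2 * t ^ s = ε ^ b := by
        rw [hts, ← Real.rpow_natCast ε 2, ← Real.rpow_add hεpos]
        congr 1
        rw [hbdef]; push_cast; field_simp; ring
      calc ε ^ 2 * ∑ y ∈ box d N, (bondPercolation (zdGraph d) (criticalProbI d)).real
            (openConnIn (↑(box d N) : Set (Site d)) 0 y) ≤ ε ^ 2 * (B * (2 ^ s * t ^ s)) :=
            mul_le_mul_of_nonneg_left h1 (sq_nonneg ε)
        _ = B * 2 ^ s * (ε ^ 2 * t ^ s) := by ring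
        _ = B * 2 ^ s * ε ^ b := by rw [h2]
    calc theta (zdGraph d) 0 p
        ≤ 2 * oneArmProb d (criticalProbI d) N + K * ε ^ 2 * ∑ y ∈ box d N,
            (bondPercolation (zdGraph d) (criticalProbI d)).real (openConnIn (↑(box d N) : Set (Site d)) 0 y) := by
          rw [hKdef, hεdef]; exact hT
      _ ≤ 2 * (A * ε ^ b) + K * (B * 2 ^ s * ε ^ b) := by
          have := mul_le_mul_of_nonneg_left hχ hK0
          nlinarith [hπ]
      _ = (2 * A + K * B * 2 ^ s) * ε ^ b := by ring
      _ ≤ (2 * A + K * B * 2 ^ s + (2 / (1 - pc)) ^ b) * ε ^ b :=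
          mul_le_mul_of_nonneg_right (by linarith [hbig0]) hεb0.le
  · -- far from `p_c`: `θ ≤ 1 ≤ (2ε/(1-p_c))^b`
    push Not at hsmall
    have hratio : 1 ≤ (2 / (1 - pc)) * ε := by
      rw [div_mul_eq_mul_div, le_div_iff₀ (by linarith)]
      rw [hε₀def] at hsmall; linarith
    have h1 : (1 : ℝ) ≤ ((2 / (1 - pc)) * ε) ^ b := Real.one_le_rpow hratio hb0.le
    have h2 : ((2 / (1 - pc)) * ε) ^ b = (2 / (1 - pc)) ^ b * ε ^ b := Real.mul_rpow (by positivity) hεpos.le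
    have hθ1 : theta (zdGraph d) 0 p ≤ 1 := measureReal_le_one
    have hfirst : 0 ≤ (2 * A + K * B * 2 ^ s) * ε ^ b := by positivity
    calc theta (zdGraph d) 0 p ≤ 1 := hθ1
      _ ≤ (2 / (1 - pc)) ^ b * ε ^ b := by rw [← h2]; exact h1
      _ ≤ (2 * A + K * B * 2 ^ s + (2 / (1 - pc)) ^ b) * ε ^ b := by nlinarith

/-- **With the one-sided two-point bound** (`d ≥ 3`): `τ_{p_c}(0,y) ≤ C‖y‖^{2−d}` (`y ≠ 0`) gives `s = 2`,
`B = 1 + 2dC·3^{d−1}`, so a one-arm rate `π_N(p_c) ≤ A N^{−c}` yields `θ(p) ≤ C''(p − p_c)^{2c/(c+2)}` for all `p ≥ p_c`.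
builds on p205010 (kernel theorem, internal audit signed; external expert review pending).
[cite: Hutchcroft2022Triangle, Thm. 1.3] [cite: HeydenreichVanDerHofstad2017, Thm. 11.4 (11.2.3)] -/
theorem thetaHolderNearCritical_of_oneArm_twoPoint_upper (hd : 3 ≤ d) {c A C : ℝ} (hc : 0 < c) (hC : 0 ≤ C)
    (hA : ∀ N : ℕ, 1 ≤ N → oneArmProb d (criticalProbI d) N ≤ A * (N : ℝ) ^ (-c))
    (hτ : ∀ y : Site d, y ≠ 0 → tau d (criticalProbI d) 0 y ≤ C * ‖y‖ ^ ((2 : ℝ) - d)) :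
    Quant.ThetaHolderNearCritical d (2 * c / (c + 2))
      (2 * A + 32 * d / ((criticalProbI d : ℝ) * (1 - criticalProbI d)) * (1 + 2 * d * C * 3 ^ (d - 1)) * 2 ^ (2 : ℝ) +
        (2 / (1 - (criticalProbI d : ℝ))) ^ (2 * c / (c + 2))) := by
  have hd2 : 2 ≤ d := by omega
  refine thetaHolderNearCritical_of_oneArm_boxSusceptibility hd2 hc two_pos hA fun N hN => ?_
  have hS := (boxSum_le_sum_tau (criticalProbI d) N).trans (sum_tau_le_of_twoPoint_upper hd2 (criticalProbI d) hC hτ N)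
  have hN1 : (1 : ℝ) ≤ N := by exact_mod_cast hN
  rw [Real.rpow_two]
  have : (1 : ℝ) ≤ (N : ℝ) ^ 2 := by nlinarith
  nlinarith [mul_nonneg (show (0:ℝ) ≤ 2 * d * C * 3 ^ (d - 1) by positivity) (sq_nonneg (N : ℝ))]

/-- **`β = 1` (bounded ratio) from the two UPPER halves `π_N(p_c) ≤ A/N²` and `τ_{p_c}(0,y) ≤ C‖y‖^{2−d}`** (`d ≥ 3`):
with `c = 2` the exponent `2c/(c+2)` is `1`, so `θ(p) ≤ C''(p − p_c)` for all `p ≥ p_c`, and the tree's mean-field lower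
bound closes the ratio (`betaEqOneBoundedRatio_of_theta_le`).  A different route from Barsky–Aizenman's (triangle condition,
extrapolation); conditional dictionary row.  builds on p205010 (kernel theorem, internal audit signed; external expert
review pending).  [cite: BarskyAizenman1991, main theorem (β = 1)] [cite: KozmaNachmias2011, Thm. 1]
[cite: HeydenreichVanDerHofstad2017, Thm. 4.1, Thm. 11.4–11.5] -/
theorem betaEqOneBoundedRatio_of_oneArm_two_twoPoint_upper (hd : 3 ≤ d) {A C : ℝ} (hC : 0 ≤ C)
    (hA : ∀ N : ℕ, 1 ≤ N → oneArmProb d (criticalProbI d) N ≤ A / (N : ℝ) ^ 2)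
    (hτ : ∀ y : Site d, y ≠ 0 → tau d (criticalProbI d) 0 y ≤ C * ‖y‖ ^ ((2 : ℝ) - d)) :
    BetaEqOneBoundedRatio d := by
  have hd2 : 2 ≤ d := by omega
  have hA' : ∀ N : ℕ, 1 ≤ N → oneArmProb d (criticalProbI d) N ≤ A * (N : ℝ) ^ (-(2 : ℝ)) := by
    intro N hN
    have hN0 : (0 : ℝ) < N := by exact_mod_cast (show 0 < N by omega)
    rw [Real.rpow_neg hN0.le, Real.rpow_two, ← div_eq_mul_inv]
    exact hA N hN
  have h := thetaHolderNearCritical_of_oneArm_twoPoint_upper hd two_pos hC hA' hτ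
  set C'' := 2 * A + 32 * d / ((criticalProbI d : ℝ) * (1 - criticalProbI d)) * (1 + 2 * d * C * 3 ^ (d - 1)) * 2 ^ (2 : ℝ) +
        (2 / (1 - (criticalProbI d : ℝ))) ^ (2 * (2 : ℝ) / (2 + 2)) with hC''
  have hexp : 2 * (2 : ℝ) / (2 + 2) = 1 := by norm_num
  refine betaEqOneBoundedRatio_of_theta_le hd2 (c₂ := C'') (δ := 1) one_pos fun p hp _ => ?_
  have := h p (by rw [coe_criticalProbI]; exact hp)
  rw [hexp, Real.rpow_one] at this
  rw [← coe_criticalProbI]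
  exact this

/-- **Packaged**: `RhoExHalf d` (its upper half `π_N(p_c) ≤ C/N²`) and `TwoPointBoundedRatio d` (its upper half
`τ_{p_c}(x,y) ≤ C‖x−y‖^{2−d}`) imply `BetaEqOneBoundedRatio d`, `d ≥ 3`.  In the tree both hypotheses are (consequences of)
named facts for `d ≥ 11` (`KozmaNachmias2011_rhoExHalf`, `Hara2008_etaZeroXSpace`); typed implication only.
builds on p205010 (kernel theorem, internal audit signed; external expert review pending).
[cite: HeydenreichVanDerHofstad2017, Thm. 4.1, Thm. 11.4 (11.2.3), Thm. 11.5 (11.3.2)] -/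
theorem betaEqOneBoundedRatio_of_rhoExHalf_twoPointBoundedRatio (hd : 3 ≤ d)
    (hρ : Literature.Barriers.CriticalPhenomena.RhoExHalf d)
    (hτ : Literature.Barriers.CriticalPhenomena.TwoPointBoundedRatio d) : BetaEqOneBoundedRatio d := by
  obtain ⟨c₀, C₀, -, hb⟩ := hρ
  obtain ⟨C', C, hC', hC'C, ht⟩ := hτ
  refine betaEqOneBoundedRatio_of_oneArm_two_twoPoint_upper hd (A := C₀) (C := C) (hC'.le.trans hC'C)
    (fun N hN => (hb N hN).2) fun y hy => ?_
  have := (ht 0 y (Ne.symm hy)).2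
  rwa [zero_sub, norm_neg] at this

end CritOneArm

end Summit.CriticalPhenomena.PercolationContinuityZ3.Theorems

end
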